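import Mathlib.LinearAlgebra.Charpoly.BaseChange
import Mathlib.RingTheory.Adjoin.Polynomial.Basic
import Literature.Algebra.Lie.LefschetzModuleHodgeInvolution
import Literature.Algebra.Lie.LefschetzSl2Type
import HarnessLib

/-!
# The algebra `K[L, ᶜΛ]` of a Lefschetz module contains `*_L`, `*_H` and the Künneth projectors (André 1996, Prop. 1.2; Kleiman 1968, 1.4.5)

Topic `Literature/Algebra/Lie` (namespace `Literature.Algebra.Lie`).  Lane `lit-hodgefound` (Track 2 foundations library),
prover seat `lit-hodgefound-p34` (generation 30, row g30-#1), a sequel of `LefschetzModule.lean` (row A1-88 of seat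
`lit-hodgefound-skel-1`: `degreeSpace`, `IsZGrading`, `HasLefschetzProperty`, the partner `f = ᶜΛ = HasLefschetzProperty.dual`),
`LefschetzModuleStringReversal.lean` (Kleiman 1.4.4: `ᶜΛ ∈ K[e, s e s] ⊆ K[e, s]` for every string reversal `s`),
`LefschetzModuleLefschetzInvolution.lean` (the constructed `*_L = lefschetzInvolution`) and `LefschetzModuleHodgeInvolution.lean`
(`*_H = hodgeInvolution`, `K[e, *_L] = K[e, *_H]`).  Those files prove the inclusions `K[e, ᶜΛ] ⊆ K[e, *_L e *_L] ⊆ K[e, *_L] = K[e, *_H]`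
of André's Proposition 1.2; this file proves the REVERSE inclusion `*_L ∈ K[e, ᶜΛ]` (Kleiman 1968, 1.4.5), hence the equality of all
four algebras, and that they contain the Künneth (degree) projectors.  PROVED theorems only (no definition, no named fact, no
`sorry`, no instance, no notation; net debt `0`).

## Sources, VERBATIM

Y. André, *Pour une théorie inconditionnelle des motifs*, Publ. Math. IHÉS **83** (1996) [Andre1996Motifs] (held
`paper:doi-10-1007-bf02698643`), §1.2 (p. 11 = p0008 L27–L29): "Notons `πʲ` le projecteur de Künneth sur `Hʲ(X)`, et posons
`h = Σ_{j=0}^{2d} (d - j) πʲ`. Alors `(ᶜΛ, h, -L)` forme un `𝔰𝔩₂`-triplet au sens de Bourbaki, Lie VIII 11.1 : `[h, ᶜΛ] = 2 ᶜΛ`,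
`[h, L] = -2L`, `[ᶜΛ, L] = h`, cf. [Kl68] 1.4.6."; Prop. 1.2 (p. 11 = p0008 L62–L66): "Les sous-algèbres `ℚ[L, *_L]`, `ℚ[L, *_H]`,
`ℚ[L, *_L L *_L]`, `ℚ[L, ᶜΛ]` de `End H*(X)` sont égales et contiennent les projecteurs de Künneth. De plus, ces algèbres sont
canoniquement isomorphes à une somme d'algèbres matricielles `M_{i+1}(ℚ)` indexée par les entiers `i` tels que `P^{d-i}(X) ≠ 0`.
[…]"; proof (p. 12 = p0009 L5): "Pour la première assertion, on renvoie à [Kl68] 1.4.4, 1.4.5."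
J. S. Milne, *Lefschetz classes on abelian varieties*, Duke Math. J. **96** (1999) [Milne1999LefschetzClasses], Thm. 5.9, proof
(p. 665): "all elements of the `ℚ`-algebra `ℚ[L, Λ]` are Lefschetz. Since this algebra contains `ᶜΛ` and `∗` (Kleiman 1968, 1.4.4)
[…]".
S. L. Kleiman, *Algebraic cycles and the Weil conjectures*, in: Dix exposés sur la cohomologie des schémas (1968) 359–386
[Kleiman1968AlgebraicCycles], §1.4, 1.4.4–1.4.6 — not held; cited through André and Milne, loc. cit.

## Rendering (dictionary, continuing the files above)

* `(M, h)` finite-dimensional and `ℤ`-graded over a field `K` of characteristic `0` (`IsZGrading h`, `M_m = degreeSpace h m`;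
  André's `Hʲ(X) = M_{j-d}` up to the sign convention of A1-88), `e = L` a Lefschetz operator (`L : HasLefschetzProperty h e`),
  `f = ᶜΛ = L.dual hgr` its `𝔰𝔩₂`-partner (`[e, f] = h`, A1-88 `lie_e_dual`), `s = *_L = L.lefschetzInvolution hgr`,
  `*_H = L.hodgeInvolution hgr d`, `*_L L *_L = s * e * s`; "`ℚ[L, ᶜΛ]`" is `Algebra.adjoin K {e, L.dual hgr}` etc.
* "le projecteur de Künneth `πʲ`": the projector of `M = ⊕ₖ M_k` onto `M_m` along the other degree parts — an operator `π` with
  `π x = x` on `M_m` and `π x = 0` on `M_k`, `k ≠ m`; André DEFINES `h` as `Σ (d - j) πʲ`, and conversely (finitely many weights)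
  each `πʲ` is a Lagrange polynomial in `h` (§1), so "contiennent les projecteurs de Künneth" follows from `h = [e, f] ∈ K[e, f]`.

## Proof (Kleiman's 1.4.5 is not held; the argument below is the standard one and is spelled out here)

`A := K[e, f]` contains `h = e f - f e` (§1), hence the degree projectors `π_m ∈ K[h]` (Lagrange interpolation over the
finitely many weights, §1).  On `M_{-k}` (`k ≥ 0`) the involution `*_L` is `eᵏ`, so `*_L π_{-k} = eᵏ π_{-k} ∈ A`.  On `M_k` (`k > 0`)
it is the inverse of `eᵏ : M_{-k} ≅ M_k`; the operator `T_k = fᵏ eᵏ π_{-k} + (1 - π_{-k}) ∈ A` is injective (`eᵏ` is injective on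
`M_{-k}` and `fᵏ` on `M_k` — the Lefschetz property of `f` for `-h`, `LefschetzSl2Type`), so by Cayley–Hamilton it has an
inverse `U_k` which is a polynomial in `T_k` (§2), and `*_L π_k = U_k fᵏ π_k ∈ A` because for `y = eᵏ z ∈ M_k` one has
`fᵏ y = T_k z`.  Summing over the weights, `*_L = Σ_m *_L π_m ∈ A` (§3).  The equalities of the four algebras (§4) combine this
with the tree's `ᶜΛ ∈ K[e, *_L e *_L]` (Kleiman 1.4.4) and `K[e, *_L] = K[e, *_H]`.

## Contents (all proved)

* §1 `finite_setOf_degreeSpace_ne_bot`, **`exists_degreeProj_mem_adjoin`** (the Künneth projector onto `M_m` is a polynomial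
  in `h`), `degreeProj_apply_mem` / `degreeProj_apply_of_mem` / `degreeProj_apply_degreeProj` / `sum_degreeProj_apply` (range,
  identity on `M_m`, idempotence, `Σ_m π_m = 1`), **`h_mem_adjoin_pair_dual`** (`h = e f - f e ∈ K[e, f]`),
  `adjoin_h_le_adjoin_pair_dual`, **`exists_degreeProj_mem_adjoin_pair_dual`** ("contiennent les projecteurs de Künneth").
* §2 (private) `exists_mem_adjoin_mul_eq_one_of_injective` (an injective endomorphism of a finite-dimensional space has a
  two-sided inverse in `K[T]`, by Cayley–Hamilton).
* §3 `eq_zero_of_pow_dual_apply_eq_zero` (`fᵏ` injective on `M_k`), `lefschetzInvolution_mul_degreeProj_neg` (`*_L π_{-k} = eᵏ π_{-k}`),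
  `injective_blockOp` (`T_k` injective), `lefschetzInvolution_mul_degreeProj_pos` (`*_L π_k = U_k fᵏ π_k`),
  **`lefschetzInvolution_mem_adjoin_pair_dual`** (`*_L ∈ K[e, ᶜΛ]`, Kleiman 1.4.5), `conj_lefschetzInvolution_mem_adjoin_pair_dual`
  (`*_L e *_L ∈ K[e, ᶜΛ]`), `hodgeInvolution_mem_adjoin_pair_dual` (`*_H ∈ K[e, ᶜΛ]`).
* §4 **André's Prop. 1.2, first assertion**: `adjoin_pair_lefschetzInvolution_eq_adjoin_pair_dual` (`K[e, *_L] = K[e, ᶜΛ]`),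
  `adjoin_pair_conj_lefschetzInvolution_eq_adjoin_pair_dual` (`K[e, *_L e *_L] = K[e, ᶜΛ]`),
  `adjoin_pair_hodgeInvolution_eq_adjoin_pair_dual` (`K[e, *_H] = K[e, ᶜΛ]`), and for ANY string reversal `s`:
  `IsStringReversal.mem_adjoin_pair_dual`, `IsStringReversal.adjoin_pair_eq_adjoin_pair_dual`; commutation corollaries
  `commute_of_mem_adjoin_pair_dual` / `commute_lefschetzInvolution_of_commute_dual` / `commute_h_of_commute_dual` (an operator
  commuting with `e` and `ᶜΛ` commutes with all of `K[e, ᶜΛ]`, in particular with `*_L` and `h`).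

## SCOPE (not formalised here)

The second assertion of Prop. 1.2 (`K[L, ᶜΛ] ≅ ⊕ᵢ M_{i+1}(ℚ)` over the `i` with `P^{d-i} ≠ 0`, and transposition for
`(x, y) ↦ ∫ x ∪ * y` = matrix transposition) is the isotypic (Wedderburn) structure of the image of `U(𝔰𝔩₂)`; not claimed.  Readings on
the exterior algebra of a symplectic space and on polarized Hodge structures (`AlgebraicGeometry/Motives/HodgeStructureExteriorAlgebra*`)
are separate rows.  The concrete-carrier statement `HodgeTheory.Andre1996_dualLefschetz_mem_adjoin_lefschetzInvolution_holds`
(`AlgebraicGeometry/HodgeTheory/DualLefschetzInLefschetzInvolutionAlgebraHolds.lean`, singular cohomology; the inclusion `ᶜΛ ∈ ℚ[L, *_L]`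
only) is announced BY NAME, not restated, not imported.

## References

* [Andre1996Motifs] Y. André, *Pour une théorie inconditionnelle des motifs*, Publ. Math. IHÉS 83 (1996) 5–49, §1.1–1.2 (pp. 10–12),
  Prop. 1.2.
* [Kleiman1968AlgebraicCycles] S. L. Kleiman, *Algebraic cycles and the Weil conjectures*, in: Dix exposés sur la cohomologie des
  schémas (1968) 359–386, §1.4 (1.4.4–1.4.6).
* [Milne1999LefschetzClasses] J. S. Milne, *Lefschetz classes on abelian varieties*, Duke Math. J. 96 (1999) 639–675, §5 Thm. 5.9
  (proof, p. 665).
* [LooijengaLunts1997] E. Looijenga, V. A. Lunts, *A Lie algebra attached to a projective variety*, Invent. Math. 129 (1997) 361–412,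
  §1 (1.1).
-/

noncomputable section

namespace Literature.Algebra.Lie

open Module Function Set
open HasLefschetzProperty (primitiveSpace mem_primitiveSpace_iff)

/-! ### §1 The Künneth (degree) projectors are polynomials in `h`; `h ∈ K[e, ᶜΛ]` -/

section Projectors

variable {K : Type*} [Field K] {M : Type*} [AddCommGroup M] [Module K M]

/-- Only finitely many degrees `k` have `M_k ≠ 0` (finite dimension: `h` has finitely many eigenvalues).
[cite: LooijengaLunts1997, §1 (1.1) p. 4 L58–L60 ("the greatest integer n with M_n ≠ 0")] -/
theorem finite_setOf_degreeSpace_ne_bot [CharZero K] [FiniteDimensional K M] (h : Module.End K M) :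
    Set.Finite {k : ℤ | degreeSpace h k ≠ ⊥} :=
  ((Module.End.finite_hasEigenvalue h).preimage (f := (Int.cast : ℤ → K)) Int.cast_injective.injOn).subset
    fun _ hk ↦ Module.End.hasEigenvalue_iff.2 hk

/-- **The Künneth projector onto `M_m` is a polynomial in `h`** ("Notons `πʲ` le projecteur de Künneth sur `Hʲ(X)`, et posons
`h = Σ (d - j) πʲ`" — conversely, the weights being finite in number, the projector of `M = ⊕ₖ M_k` onto `M_m` is the Lagrange
polynomial `∏_{k ≠ m, M_k ≠ 0} (m - k)⁻¹ (h - k)` in `h`): there is `π ∈ K[h]` with `π = 1` on `M_m` and `π = 0` on every other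
`M_k`. [cite: Andre1996Motifs, §1.2 (p. 11, definition of h from the Künneth projectors)] -/
theorem exists_degreeProj_mem_adjoin [CharZero K] [FiniteDimensional K M] (h : Module.End K M) (m : ℤ) :
    ∃ π ∈ Algebra.adjoin K ({h} : Set (Module.End K M)),
      ∀ (k : ℤ) (x : M), x ∈ degreeSpace h k → π x = if k = m then x else 0 := by
  classical
  set S : Finset ℤ := (finite_setOf_degreeSpace_ne_bot h).toFinset with hS
  -- the Lagrange polynomial `P = ∏_{k ∈ S, k ≠ m} (m - k)⁻¹ (X - k)`
  set P : Polynomial K :=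
    ∏ k ∈ S.erase m, (Polynomial.C (((m : K) - k)⁻¹) * (Polynomial.X - Polynomial.C (k : K))) with hP
  refine ⟨Polynomial.aeval h P, Polynomial.aeval_mem_adjoin_singleton K h, fun k x hx ↦ ?_⟩
  have hx' : h x = (k : K) • x := mem_degreeSpace_iff.1 hx
  rw [Module.End.aeval_apply_of_mem_apply_eq_smul hx', hP, Polynomial.eval_prod]
  simp only [Polynomial.eval_mul, Polynomial.eval_C, Polynomial.eval_sub, Polynomial.eval_X]
  split_ifs with hkm
  · subst hkm
    rw [Finset.prod_eq_one, one_smul]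
    intro j hj
    have hjm : (k : K) - j ≠ 0 := by
      rw [sub_ne_zero]
      exact_mod_cast (Finset.ne_of_mem_erase hj).symm
    exact inv_mul_cancel₀ hjm
  · by_cases hk : k ∈ S
    · rw [Finset.prod_eq_zero (Finset.mem_erase.2 ⟨hkm, hk⟩) (by rw [sub_self, mul_zero]), zero_smul]
    · have hbot : degreeSpace h k = ⊥ := by
        by_contra hne
        exact hk ((finite_setOf_degreeSpace_ne_bot h).mem_toFinset.2 hne)
      rw [hbot, Submodule.mem_bot] at hx
      rw [hx, smul_zero]

/-- A degree projector maps everything into `M_m` (`M = ⊕ₖ M_k`). [cite: Andre1996Motifs, §1.2 (p. 11, Künneth projectors)] -/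
theorem degreeProj_apply_mem {h : Module.End K M} (hgr : IsZGrading h) {m : ℤ} {π : Module.End K M}
    (hπ : ∀ (k : ℤ) (x : M), x ∈ degreeSpace h k → π x = if k = m then x else 0) (x : M) :
    π x ∈ degreeSpace h m := by
  have hx : x ∈ ⨆ k : ℤ, degreeSpace h k := by rw [hgr]; exact Submodule.mem_top
  refine Submodule.iSup_induction (fun k : ℤ ↦ degreeSpace h k) (motive := fun x ↦ π x ∈ degreeSpace h m) hx
    (fun k x hx ↦ ?_) (by rw [map_zero]; exact Submodule.zero_mem _)
    (fun x y hx hy ↦ by rw [map_add]; exact Submodule.add_mem _ hx hy)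
  rw [hπ k x hx]
  split_ifs with hkm
  · exact hkm ▸ hx
  · exact Submodule.zero_mem _

/-- A degree projector is the identity on `M_m`. [cite: Andre1996Motifs, §1.2 (p. 11, Künneth projectors)] -/
theorem degreeProj_apply_of_mem {h : Module.End K M} {m : ℤ} {π : Module.End K M}
    (hπ : ∀ (k : ℤ) (x : M), x ∈ degreeSpace h k → π x = if k = m then x else 0) {x : M} (hx : x ∈ degreeSpace h m) :
    π x = x := by
  rw [hπ m x hx, if_pos rfl]

/-- A degree projector is idempotent. [cite: Andre1996Motifs, §1.2 (p. 11, "projecteur de Künneth")] -/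
theorem degreeProj_apply_degreeProj {h : Module.End K M} (hgr : IsZGrading h) {m : ℤ} {π : Module.End K M}
    (hπ : ∀ (k : ℤ) (x : M), x ∈ degreeSpace h k → π x = if k = m then x else 0) (x : M) :
    π (π x) = π x :=
  degreeProj_apply_of_mem hπ (degreeProj_apply_mem hgr hπ x)

/-- **The degree projectors sum to the identity** over any finite set of degrees containing the weights of `M`
(`M = ⊕ₖ M_k`). [cite: Andre1996Motifs, §1.2 (p. 11, Künneth projectors)] -/
theorem sum_degreeProj_apply {h : Module.End K M} (hgr : IsZGrading h) {S : Finset ℤ}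
    (hS : ∀ k : ℤ, degreeSpace h k ≠ ⊥ → k ∈ S) {π : ℤ → Module.End K M}
    (hπ : ∀ m ∈ S, ∀ (k : ℤ) (x : M), x ∈ degreeSpace h k → π m x = if k = m then x else 0) (x : M) :
    ∑ m ∈ S, π m x = x := by
  have hx : x ∈ ⨆ k : ℤ, degreeSpace h k := by rw [hgr]; exact Submodule.mem_top
  refine Submodule.iSup_induction (fun k : ℤ ↦ degreeSpace h k) (motive := fun x ↦ ∑ m ∈ S, π m x = x) hx
    (fun k x hx ↦ ?_) (by simp only [map_zero, Finset.sum_const_zero])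
    (fun x y hx hy ↦ by simp only [map_add, Finset.sum_add_distrib, hx, hy])
  by_cases hk : k ∈ S
  · rw [Finset.sum_eq_single_of_mem k hk fun m hm hmk ↦ by rw [hπ m hm k x hx, if_neg (Ne.symm hmk)],
      hπ k hk k x hx, if_pos rfl]
  · have hbot : degreeSpace h k = ⊥ := by
      by_contra hne
      exact hk (hS k hne)
    rw [hbot, Submodule.mem_bot] at hx
    simp only [hx, map_zero, Finset.sum_const_zero]

variable [CharZero K] {h e : Module.End K M}

namespace HasLefschetzProperty

/-- **`[ᶜΛ, L] = h` read in `K[e, ᶜΛ]`: `h = e f - f e` lies in the subalgebra generated by `e` and `f = ᶜΛ`** ("cf. [Kl68] 1.4.6").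
[cite: Andre1996Motifs, §1.2 (p. 11)] [cite: Kleiman1968AlgebraicCycles, §1.4, 1.4.6] -/
theorem h_mem_adjoin_pair_dual [FiniteDimensional K M] (L : HasLefschetzProperty h e) (hgr : IsZGrading h) :
    h ∈ Algebra.adjoin K ({e, L.dual hgr} : Set (Module.End K M)) := by
  have he : e ∈ Algebra.adjoin K ({e, L.dual hgr} : Set (Module.End K M)) := Algebra.subset_adjoin (Set.mem_insert _ _)
  have hf : L.dual hgr ∈ Algebra.adjoin K ({e, L.dual hgr} : Set (Module.End K M)) :=
    Algebra.subset_adjoin (Set.mem_insert_of_mem _ rfl)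
  have h1 : e * L.dual hgr - L.dual hgr * e = h := by rw [← Ring.lie_def]; exact L.lie_e_dual hgr
  have hmem : e * L.dual hgr - L.dual hgr * e ∈ Algebra.adjoin K ({e, L.dual hgr} : Set (Module.End K M)) :=
    Subalgebra.sub_mem _ (Subalgebra.mul_mem _ he hf) (Subalgebra.mul_mem _ hf he)
  rwa [h1] at hmem

/-- `K[h] ⊆ K[e, ᶜΛ]`. [cite: Andre1996Motifs, §1.2 (p. 11)] -/
theorem adjoin_h_le_adjoin_pair_dual [FiniteDimensional K M] (L : HasLefschetzProperty h e) (hgr : IsZGrading h) :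
    Algebra.adjoin K ({h} : Set (Module.End K M)) ≤ Algebra.adjoin K ({e, L.dual hgr} : Set (Module.End K M)) :=
  Algebra.adjoin_le (Set.singleton_subset_iff.2 (L.h_mem_adjoin_pair_dual hgr))

/-- **"… et contiennent les projecteurs de Künneth": the degree projector onto `M_m` lies in `K[e, ᶜΛ]`** (it is a polynomial
in `h = [e, f]`). [cite: Andre1996Motifs, Prop. 1.2 (p. 11)] [cite: Kleiman1968AlgebraicCycles, §1.4, 1.4.5] -/
theorem exists_degreeProj_mem_adjoin_pair_dual [FiniteDimensional K M] (L : HasLefschetzProperty h e) (hgr : IsZGrading h)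
    (m : ℤ) : ∃ π ∈ Algebra.adjoin K ({e, L.dual hgr} : Set (Module.End K M)),
      ∀ (k : ℤ) (x : M), x ∈ degreeSpace h k → π x = if k = m then x else 0 := by
  obtain ⟨π, hπA, hπ⟩ := exists_degreeProj_mem_adjoin h m
  exact ⟨π, L.adjoin_h_le_adjoin_pair_dual hgr hπA, hπ⟩

end HasLefschetzProperty

end Projectors

/-! ### §2 An injective endomorphism has an inverse in `K[T]` (Cayley–Hamilton) -/

section Inverse

variable {K : Type*} [Field K] {M : Type*} [AddCommGroup M] [Module K M] [FiniteDimensional K M]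

/-- **An injective endomorphism `T` of a finite-dimensional vector space has a two-sided inverse which is a polynomial in `T`**:
by Cayley–Hamilton `χ_T(T) = 0` with `χ_T(0) = ± det T ≠ 0`, so `U = -χ_T(0)⁻¹ · (χ_T / X)(T)` satisfies `U T = T U = 1`.
[folklore] -/
private theorem exists_mem_adjoin_mul_eq_one_of_injective (T : Module.End K M) (hT : Function.Injective T) :
    ∃ U ∈ Algebra.adjoin K ({T} : Set (Module.End K M)), U * T = 1 ∧ T * U = 1 := by
  have hunit : IsUnit T := (LinearMap.isUnit_iff_ker_eq_bot T).2 (LinearMap.ker_eq_bot.2 hT)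
  set c : K := T.charpoly.coeff 0 with hc
  have hc0 : c ≠ 0 := by
    have hdet : IsUnit (LinearMap.det T) := LinearMap.isUnit_det T hunit
    rw [LinearMap.det_eq_sign_charpoly_coeff] at hdet
    exact (IsUnit.mul_iff.1 hdet).2.ne_zero
  set q : Polynomial K := T.charpoly.divX with hq
  -- Cayley–Hamilton: `q(T) T + c = χ_T(T) = 0`
  have hCH : Polynomial.aeval T q * T = -(algebraMap K (Module.End K M) c) := by
    have h1 := congrArg (Polynomial.aeval T) (Polynomial.divX_mul_X_add T.charpoly)
    rw [map_add, map_mul, Polynomial.aeval_X, Polynomial.aeval_C, LinearMap.aeval_self_charpoly] at h1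
    exact eq_neg_of_add_eq_zero_left h1
  have hcomm : T * Polynomial.aeval T q = Polynomial.aeval T q * T := by
    have h1 := congrArg (Polynomial.aeval T) (mul_comm (Polynomial.X : Polynomial K) q)
    simpa only [map_mul, Polynomial.aeval_X] using h1
  have hUT : ((-c⁻¹) • Polynomial.aeval T q) * T = 1 := by
    rw [smul_mul_assoc, hCH, smul_neg, Algebra.algebraMap_eq_smul_one, smul_smul, ← neg_smul, neg_mul, neg_neg,
      inv_mul_cancel₀ hc0, one_smul]
  refine ⟨(-c⁻¹) • Polynomial.aeval T q, Subalgebra.smul_mem _ (Polynomial.aeval_mem_adjoin_singleton K T) _, hUT, ?_⟩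
  rwa [mul_smul_comm, hcomm, ← smul_mul_assoc]

end Inverse

/-! ### §3 `*_L ∈ K[e, ᶜΛ]` (Kleiman 1968, 1.4.5) -/

section Kleiman

variable {K : Type*} [Field K] [CharZero K] {M : Type*} [AddCommGroup M] [Module K M] [FiniteDimensional K M]
  {h e : Module.End K M}

namespace HasLefschetzProperty

/-- `fᵏ` is injective on `M_k` (`f = ᶜΛ` is a Lefschetz operator for `-h`; for `h = 0` there is nothing to prove as `M_k = 0`,
`k > 0`). [cite: LooijengaLunts1997, §1 (1.1) p. 4 L1–L5] -/
theorem eq_zero_of_pow_dual_apply_eq_zero (L : HasLefschetzProperty h e) (hgr : IsZGrading h) {k : ℕ} {x : M}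
    (hx : x ∈ degreeSpace h (k : ℤ)) (h0 : (L.dual hgr ^ k) x = 0) : x = 0 := by
  by_cases hh : h = 0
  · rcases Nat.eq_zero_or_pos k with rfl | hk
    · simpa using h0
    · rw [degreeSpace_eq_bot_of_eq_zero hh (k := (k : ℤ)) (by exact_mod_cast hk.ne'), Submodule.mem_bot] at hx
      exact hx
  · exact eq_zero_of_pow_f_apply_eq_zero hgr (L.isSl2Triple_dual hgr hh) hx h0

omit [FiniteDimensional K M] in
/-- **`*_L` restricted to a non-positive degree lies in `K[e, ᶜΛ]`**: for a degree projector `π` onto `M_{-k}` one has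
`*_L π = eᵏ π` ("`*_L` … l'isomorphisme de Lefschetz", i.e. `L^{d-j}` on `Hʲ`, `j ≤ d`). [cite: Andre1996Motifs, §0.2 (p. 7), §1.1 (p. 10)] -/
theorem lefschetzInvolution_mul_degreeProj_neg (L : HasLefschetzProperty h e) (hgr : IsZGrading h) {k : ℕ}
    {π : Module.End K M} (hπ : ∀ (j : ℤ) (x : M), x ∈ degreeSpace h j → π x = if j = -(k : ℤ) then x else 0) :
    L.lefschetzInvolution hgr * π = e ^ k * π := by
  ext x
  rw [Module.End.mul_apply, Module.End.mul_apply,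
    L.lefschetzInvolution_apply_of_mem_neg hgr (degreeProj_apply_mem hgr hπ x)]

/-- **The operator `T_k = fᵏ eᵏ π_{-k} + (1 - π_{-k})` is injective** (`eᵏ : M_{-k} ≅ M_k` and `fᵏ` injective on `M_k`; on the
other degree parts `T_k` is the identity). [cite: LooijengaLunts1997, §1 (1.1) p. 4 L1–L5] [cite: Kleiman1968AlgebraicCycles, §1.4, 1.4.5] -/
theorem injective_blockOp (L : HasLefschetzProperty h e) (hgr : IsZGrading h) {k : ℕ} {π : Module.End K M}
    (hπ : ∀ (j : ℤ) (x : M), x ∈ degreeSpace h j → π x = if j = -(k : ℤ) then x else 0) :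
    Function.Injective ⇑(L.dual hgr ^ k * e ^ k * π + (1 - π) : Module.End K M) := by
  set f := L.dual hgr with hf
  rw [← LinearMap.ker_eq_bot, Submodule.eq_bot_iff]
  intro x hx
  rw [LinearMap.mem_ker, LinearMap.add_apply, Module.End.mul_apply, Module.End.mul_apply, LinearMap.sub_apply,
    Module.End.one_apply] at hx
  have hπx : π x ∈ degreeSpace h (-(k : ℤ)) := degreeProj_apply_mem hgr hπ x
  have hex : (e ^ k) (π x) ∈ degreeSpace h (k : ℤ) := L.pow_apply_mem_of_mem_neg hπx
  have hfex : (f ^ k) ((e ^ k) (π x)) ∈ degreeSpace h (-(k : ℤ)) := by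
    have h1 := pow_apply_mem_degreeSpace_of_neg (L.lie_h_dual hgr) hex k
    rwa [show ((k : ℤ) - 2 * (k : ℕ) : ℤ) = -(k : ℤ) by ring] at h1
  -- apply `π`: `π T x = fᵏ eᵏ π x`
  have h2 : (f ^ k) ((e ^ k) (π x)) = 0 := by
    have h3 := congrArg π hx
    rw [map_zero, map_add, map_sub, degreeProj_apply_of_mem hπ hfex, degreeProj_apply_degreeProj hgr hπ, sub_self,
      add_zero] at h3
    exact h3
  have h4 : π x = 0 :=
    L.eq_zero_of_pow_apply_eq_zero (n := (k : ℤ)) (by omega) hπx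
      (by rw [Int.toNat_natCast]; exact L.eq_zero_of_pow_dual_apply_eq_zero hgr hex h2)
  rw [h4, map_zero, map_zero, zero_add, sub_zero] at hx
  exact hx

omit [FiniteDimensional K M] in
/-- **`*_L` restricted to a positive degree lies in `K[e, ᶜΛ]`** ("… ou son inverse", i.e. `(L^{j-d})⁻¹` on `Hʲ`, `j > d`): for degree
projectors `π_{±k}` onto `M_{±k}` (`k > 0`) and a left inverse `U` of `T_k = fᵏ eᵏ π_{-k} + (1 - π_{-k})`, one has
`*_L π_k = U fᵏ π_k` — for `y = eᵏ z ∈ M_k`, `fᵏ y = T_k z`. [cite: Andre1996Motifs, §0.2 (p. 7), §1.1 (p. 10)]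
[cite: Kleiman1968AlgebraicCycles, §1.4, 1.4.5] -/
theorem lefschetzInvolution_mul_degreeProj_pos (L : HasLefschetzProperty h e) (hgr : IsZGrading h) {k : ℕ}
    {π π' U : Module.End K M} (hπ : ∀ (j : ℤ) (x : M), x ∈ degreeSpace h j → π x = if j = -(k : ℤ) then x else 0)
    (hπ' : ∀ (j : ℤ) (x : M), x ∈ degreeSpace h j → π' x = if j = (k : ℤ) then x else 0)
    (hU : U * (L.dual hgr ^ k * e ^ k * π + (1 - π)) = 1) :
    L.lefschetzInvolution hgr * π' = U * L.dual hgr ^ k * π' := by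
  ext x
  set y := π' x with hy_def
  have hy : y ∈ degreeSpace h (k : ℤ) := degreeProj_apply_mem hgr hπ' x
  set z := L.lefschetzInvolution hgr y with hz_def
  have hz : z ∈ degreeSpace h (-(k : ℤ)) := L.lefschetzInvolution_apply_mem_neg_of_mem_pos hgr hy
  have hyz : (e ^ k) z = y := L.pow_apply_lefschetzInvolution_of_mem_pos hgr hy
  -- `T_k z = fᵏ eᵏ z = fᵏ y`
  have hT : (L.dual hgr ^ k * e ^ k * π + (1 - π)) z = (L.dual hgr ^ k) y := by
    rw [LinearMap.add_apply, Module.End.mul_apply, Module.End.mul_apply, LinearMap.sub_apply, Module.End.one_apply,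
      degreeProj_apply_of_mem hπ hz, sub_self, add_zero, hyz]
  rw [Module.End.mul_apply, Module.End.mul_apply, Module.End.mul_apply, ← hy_def, ← hz_def, ← hT, ← Module.End.mul_apply, hU,
    Module.End.one_apply]

/-- **Kleiman 1968, 1.4.5 / André 1996, Prop. 1.2: the Lefschetz involution `*_L` lies in `K[e, ᶜΛ]`** ("Les sous-algèbres
`ℚ[L, *_L]`, […], `ℚ[L, ᶜΛ]` […] sont égales"; Milne: "this algebra contains `ᶜΛ` and `∗`"): `*_L = Σ_m *_L π_m` with
`*_L π_{-k} = eᵏ π_{-k}` and `*_L π_k = U_k fᵏ π_k`, all in `K[e, f]`. [cite: Andre1996Motifs, Prop. 1.2 (p. 11)]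
[cite: Kleiman1968AlgebraicCycles, §1.4, 1.4.5] [cite: Milne1999LefschetzClasses, §5 Thm. 5.9 (proof, p. 665)] -/
theorem lefschetzInvolution_mem_adjoin_pair_dual (L : HasLefschetzProperty h e) (hgr : IsZGrading h) :
    L.lefschetzInvolution hgr ∈ Algebra.adjoin K ({e, L.dual hgr} : Set (Module.End K M)) := by
  classical
  set A := Algebra.adjoin K ({e, L.dual hgr} : Set (Module.End K M)) with hA
  have he : e ∈ A := Algebra.subset_adjoin (Set.mem_insert _ _)
  have hf : L.dual hgr ∈ A := Algebra.subset_adjoin (Set.mem_insert_of_mem _ rfl)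
  -- degree projectors in `A`, one for each degree
  choose π hπA hπ using fun m : ℤ ↦ L.exists_degreeProj_mem_adjoin_pair_dual hgr m
  -- `*_L π_m ∈ A` for every `m`
  have hsπ : ∀ m : ℤ, L.lefschetzInvolution hgr * π m ∈ A := by
    intro m
    rcases le_or_gt m 0 with hm | hm
    · obtain ⟨k, rfl⟩ : ∃ k : ℕ, m = -(k : ℤ) := ⟨(-m).toNat, by omega⟩
      rw [L.lefschetzInvolution_mul_degreeProj_neg hgr (hπ _)]
      exact Subalgebra.mul_mem _ (Subalgebra.pow_mem _ he _) (hπA _)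
    · obtain ⟨k, rfl⟩ : ∃ k : ℕ, m = (k : ℤ) := ⟨m.toNat, by omega⟩
      obtain ⟨U, hUA, hU, -⟩ := exists_mem_adjoin_mul_eq_one_of_injective _ (L.injective_blockOp hgr (hπ (-(k : ℤ))))
      rw [L.lefschetzInvolution_mul_degreeProj_pos hgr (hπ (-(k : ℤ))) (hπ k) hU]
      have hT : L.dual hgr ^ k * e ^ k * π (-(k : ℤ)) + (1 - π (-(k : ℤ))) ∈ A :=
        Subalgebra.add_mem _ (Subalgebra.mul_mem _ (Subalgebra.mul_mem _ (Subalgebra.pow_mem _ hf _)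
          (Subalgebra.pow_mem _ he _)) (hπA _)) (Subalgebra.sub_mem _ (Subalgebra.one_mem _) (hπA _))
      have hUA' : U ∈ A := Algebra.adjoin_le (Set.singleton_subset_iff.2 hT) hUA
      exact Subalgebra.mul_mem _ (Subalgebra.mul_mem _ hUA' (Subalgebra.pow_mem _ hf _)) (hπA _)
  -- `*_L = Σ_{m ∈ S} *_L π_m` over the finite set of weights
  set S : Finset ℤ := (finite_setOf_degreeSpace_ne_bot h).toFinset with hS
  have hsum : L.lefschetzInvolution hgr = ∑ m ∈ S, L.lefschetzInvolution hgr * π m := by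
    rw [← Finset.mul_sum]
    conv_lhs => rw [← mul_one (L.lefschetzInvolution hgr)]
    congr 1
    ext x
    rw [Module.End.one_apply, LinearMap.coe_sum, Finset.sum_apply]
    exact (sum_degreeProj_apply hgr (fun k hk ↦ (finite_setOf_degreeSpace_ne_bot h).mem_toFinset.2 hk)
      (fun m _ ↦ hπ m) x).symm
  rw [hsum]
  exact Subalgebra.sum_mem _ fun m _ ↦ hsπ m

/-- **`*_L e *_L ∈ K[e, ᶜΛ]`.** [cite: Andre1996Motifs, Prop. 1.2 (p. 11)] [cite: Kleiman1968AlgebraicCycles, §1.4, 1.4.5] -/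
theorem conj_lefschetzInvolution_mem_adjoin_pair_dual (L : HasLefschetzProperty h e) (hgr : IsZGrading h) :
    L.lefschetzInvolution hgr * e * L.lefschetzInvolution hgr ∈ Algebra.adjoin K ({e, L.dual hgr} : Set (Module.End K M)) :=
  Subalgebra.mul_mem _ (Subalgebra.mul_mem _ (L.lefschetzInvolution_mem_adjoin_pair_dual hgr)
    (Algebra.subset_adjoin (Set.mem_insert _ _))) (L.lefschetzInvolution_mem_adjoin_pair_dual hgr)

/-- **`*_H ∈ K[e, ᶜΛ]`** (through `*_H ∈ K[e, *_L]`, `LefschetzModuleHodgeInvolution`). [cite: Andre1996Motifs, Prop. 1.2 (p. 11)]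
[cite: Kleiman1968AlgebraicCycles, §1.4, 1.4.5] -/
theorem hodgeInvolution_mem_adjoin_pair_dual (L : HasLefschetzProperty h e) (hgr : IsZGrading h) (d : ℕ) :
    L.hodgeInvolution hgr d ∈ Algebra.adjoin K ({e, L.dual hgr} : Set (Module.End K M)) := by
  refine Algebra.adjoin_le ?_ (L.hodgeInvolution_mem_adjoin hgr d)
  rintro x (rfl | rfl)
  · exact Algebra.subset_adjoin (Set.mem_insert _ _)
  · exact L.lefschetzInvolution_mem_adjoin_pair_dual hgr

/-! ### §4 André's Proposition 1.2, first assertion: the four algebras coincide -/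

/-- **`K[e, *_L] = K[e, ᶜΛ]`** ("Les sous-algèbres `ℚ[L, *_L]`, […], `ℚ[L, ᶜΛ]` de `End H*(X)` sont égales"): `⊆` by
`lefschetzInvolution_mem_adjoin_pair_dual` (Kleiman 1.4.5), `⊇` by `dual_mem_adjoin_lefschetzInvolution` (Kleiman 1.4.4).
[cite: Andre1996Motifs, Prop. 1.2 (p. 11)] [cite: Kleiman1968AlgebraicCycles, §1.4, 1.4.4–1.4.5] -/
theorem adjoin_pair_lefschetzInvolution_eq_adjoin_pair_dual (L : HasLefschetzProperty h e) (hgr : IsZGrading h) :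
    Algebra.adjoin K ({e, L.lefschetzInvolution hgr} : Set (Module.End K M)) =
      Algebra.adjoin K ({e, L.dual hgr} : Set (Module.End K M)) := by
  refine le_antisymm (Algebra.adjoin_le ?_) (Algebra.adjoin_le ?_)
  · rintro x (rfl | rfl)
    · exact Algebra.subset_adjoin (Set.mem_insert _ _)
    · exact L.lefschetzInvolution_mem_adjoin_pair_dual hgr
  · rintro x (rfl | rfl)
    · exact Algebra.subset_adjoin (Set.mem_insert _ _)
    · exact L.dual_mem_adjoin_lefschetzInvolution hgr

/-- **`K[e, *_L e *_L] = K[e, ᶜΛ]`** (`⊇`: `ᶜΛ` is Kleiman's polynomial in `e` and `N = *_L e *_L`, 1.4.4).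
[cite: Andre1996Motifs, Prop. 1.2 (p. 11)] [cite: Kleiman1968AlgebraicCycles, §1.4, 1.4.4–1.4.5] -/
theorem adjoin_pair_conj_lefschetzInvolution_eq_adjoin_pair_dual (L : HasLefschetzProperty h e) (hgr : IsZGrading h) :
    Algebra.adjoin K ({e, L.lefschetzInvolution hgr * e * L.lefschetzInvolution hgr} : Set (Module.End K M)) =
      Algebra.adjoin K ({e, L.dual hgr} : Set (Module.End K M)) := by
  refine le_antisymm (Algebra.adjoin_le ?_) (Algebra.adjoin_le ?_)
  · rintro x (rfl | rfl)
    · exact Algebra.subset_adjoin (Set.mem_insert _ _)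
    · exact L.conj_lefschetzInvolution_mem_adjoin_pair_dual hgr
  · rintro x (rfl | rfl)
    · exact Algebra.subset_adjoin (Set.mem_insert _ _)
    · exact L.dual_mem_adjoin_conj_lefschetzInvolution hgr

/-- **`K[e, *_H] = K[e, ᶜΛ]`** (through `K[e, *_L] = K[e, *_H]` of `LefschetzModuleHodgeInvolution`).
[cite: Andre1996Motifs, Prop. 1.2 (p. 11)] [cite: Kleiman1968AlgebraicCycles, §1.4, 1.4.4–1.4.5] -/
theorem adjoin_pair_hodgeInvolution_eq_adjoin_pair_dual (L : HasLefschetzProperty h e) (hgr : IsZGrading h) (d : ℕ) :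
    Algebra.adjoin K ({e, L.hodgeInvolution hgr d} : Set (Module.End K M)) =
      Algebra.adjoin K ({e, L.dual hgr} : Set (Module.End K M)) := by
  rw [← L.adjoin_pair_lefschetzInvolution_eq_adjoin_pair_hodgeInvolution hgr d,
    L.adjoin_pair_lefschetzInvolution_eq_adjoin_pair_dual hgr]

omit [FiniteDimensional K M] in
/-- **An operator commuting with `e` and `ᶜΛ` commutes with all of `K[e, ᶜΛ]`** — in particular with `*_L`, `*_H`, `*_L e *_L`
and the Künneth projectors. [cite: Andre1996Motifs, Prop. 1.2 (p. 11)] [cite: Milne1999LefschetzClasses, §5 Thm. 5.9 (proof, p. 665)] -/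
theorem commute_of_mem_adjoin_pair_dual (L : HasLefschetzProperty h e) (hgr : IsZGrading h) {u x : Module.End K M}
    (hue : Commute u e) (huf : Commute u (L.dual hgr))
    (hx : x ∈ Algebra.adjoin K ({e, L.dual hgr} : Set (Module.End K M))) : Commute u x :=
  commute_of_mem_adjoin_pair hue huf hx

/-- An operator commuting with `e` and `ᶜΛ` commutes with `*_L`. [cite: Andre1996Motifs, Prop. 1.2 (p. 11)]
[cite: Milne1999LefschetzClasses, §5 Thm. 5.9 (proof, p. 665)] -/
theorem commute_lefschetzInvolution_of_commute_dual (L : HasLefschetzProperty h e) (hgr : IsZGrading h) {u : Module.End K M}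
    (hue : Commute u e) (huf : Commute u (L.dual hgr)) : Commute u (L.lefschetzInvolution hgr) :=
  L.commute_of_mem_adjoin_pair_dual hgr hue huf (L.lefschetzInvolution_mem_adjoin_pair_dual hgr)

/-- An operator commuting with `e` and `ᶜΛ` commutes with `h` (it preserves the grading). [cite: Andre1996Motifs, §1.2 (p. 11)] -/
theorem commute_h_of_commute_dual (L : HasLefschetzProperty h e) (hgr : IsZGrading h) {u : Module.End K M}
    (hue : Commute u e) (huf : Commute u (L.dual hgr)) : Commute u h :=
  L.commute_of_mem_adjoin_pair_dual hgr hue huf (L.h_mem_adjoin_pair_dual hgr)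

end HasLefschetzProperty

/-- **Prop. 1.2 for ANY string reversal `s`** (they are all equal to the constructed `*_L`): `s ∈ K[e, ᶜΛ]`.
[cite: Andre1996Motifs, Prop. 1.2 (p. 11)] [cite: Kleiman1968AlgebraicCycles, §1.4, 1.4.5] -/
theorem IsStringReversal.mem_adjoin_pair_dual {s : Module.End K M} (hs : IsStringReversal h e s) (L : HasLefschetzProperty h e)
    (hgr : IsZGrading h) : s ∈ Algebra.adjoin K ({e, L.dual hgr} : Set (Module.End K M)) := by
  rw [hs.eq_lefschetzInvolution L hgr]
  exact L.lefschetzInvolution_mem_adjoin_pair_dual hgr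

/-- **`K[e, s] = K[e, ᶜΛ]` for any string reversal `s`.** [cite: Andre1996Motifs, Prop. 1.2 (p. 11)]
[cite: Kleiman1968AlgebraicCycles, §1.4, 1.4.4–1.4.5] -/
theorem IsStringReversal.adjoin_pair_eq_adjoin_pair_dual {s : Module.End K M} (hs : IsStringReversal h e s)
    (L : HasLefschetzProperty h e) (hgr : IsZGrading h) :
    Algebra.adjoin K ({e, s} : Set (Module.End K M)) = Algebra.adjoin K ({e, L.dual hgr} : Set (Module.End K M)) := by
  rw [hs.eq_lefschetzInvolution L hgr]
  exact L.adjoin_pair_lefschetzInvolution_eq_adjoin_pair_dual hgr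

end Kleiman

end Literature.Algebra.Lie

end
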